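import Summits.ResolutionOfSingularities.ResolutionOfSingularities.Theorems.CompanionTowers
import HarnessLib

/-!
# CompanionCutCells — decomp-res node «CompanionCut» (lens-4 g26, critic row 154), tree file 6/7 of the node

Content VERBATIM from the decomp-res lens-4 g26 node `HOME/decomp-res-lens-4/g26/CompanionCut.lean` (pin 12d9bf52, 1
262 l, 56 declarations;
HOME = run/shared/lean/pub/decomp-res) = ONE NEW PART §66–§70, NO CARRY, on top of the landed
`Theorems/HeightCutCells` (g25) +
`Theorems/MaxContactCutKangarooCut` (h71 wiring) + `Theorems/ContactFreeIsPPower` (lens-6).  Critic: CRITIC-LEDGER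
row 154 (CLEARED
2026-08-30T23:45:15Z, DECIDED +1 (ii*): THE COMPANION LAW at every weight — Hasse descent of a `p^e`-power form to
a weight-`p^e`
companion with LINEAR weak contact, Giraud transport with a typed jump dichotomy in every weight, the deciding implication
«eventually companion-jump-free ⇒ 31571's class» and the EXACT re-location of the g25 residual
`NoWildKangarooOffDoublePointTowers`
to the companion-recurrent towers `NoWildCompanionKangarooTowers`; inhabitants both sides).  Landing orders INBOX
:519 (lens-4 g26
landing note, split per NEXT-g27 §4) and :528 (critic): `--kind proof --supports
stmt-ResolutionOfSingularities-28338`, namespace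
`…Theorems.HugValuationCut`.  Landed by decomp-res writer g8 CONE-AWARE in seven files: `CompanionAlgebra` ·
`CompanionHasse` ·
`CompanionPresentation` (§66–§67) · `CompanionTransport` (§68) · `CompanionTowers` (§69) ·
`CompanionCutCells` (§70 cone-free cells and
hypothesis-free re-locations) are OUTSIDE the Theses cone (importable by the route file); the five §70 corollaries GIVEN 31571
`MaxContactCut.NoContactHuggingTowers` BY NAME are the in-cone wiring file `MaxContactCutCompanionCut`.  Aside
bookkeeping (row 154):
ONE successor aside on the lens-4 column, `NoWildCompanionKangarooTowers` (home `CompanionCutCells`) SUPERSEDING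
`HCNoWildKangarooOffDoublePointTowers` (g25, route rev 43); exactness `noWildKangarooOffDoublePointTowers_iff_companion (h71)`;
the decided cell `NoWildCompanionJumpFreeTowers` (⟸ 31571, `noWildCompanionJumpFreeTowers_of_item`) is not filed.

§70 (l. 1132–1258), CONE-FREE PART: the cells `WildCompanionJumpFreeTowersTerminate` (DECIDED ⟸ 31571 by name,
in the wiring file) /
`WildCompanionKangarooTowersTerminate` (THE LOCATED RESIDUAL after g26), BY NAME `NoWildCompanionJumpFreeTowers` /
**`NoWildCompanionKangarooTowers`** (= the successor aside's statement), the exact split `wildKangarooOffDoublePoint_iff_g26`,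
`noWildKangarooOffDoublePointTowers_iff_g26` (hypothesis-free), up-links `noWildCompanionKangarooTowers_of_g25 /
_of_aside`, and the class-level
inclusion `noTowerWild_jumpFree_of_companionJumpFree`.  Imports `CompanionTowers`.  Cone-free (the five 31571 corollaries are in
`MaxContactCutCompanionCut`).

[WRITER NOTE (decomp-res writer g8): section split only (400-line cap; §66 `section CompanionAlgebra` is re-opened
with the same
`variable` lines in `CompanionHasse` / `CompanionPresentation`); namespace, universes, section variables and every
declaration exactly
as in the lens (global `set_option` dropped; the lens's in-cone import `MaxContactCutKangarooCut` and the `open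
…Theses` line live only
in the wiring file `MaxContactCutCompanionCut`).]

(Sources: Giraud1975 Thm 5.2; EncinasVillamayor2000 Thm 4.9; BravoGarciaEscamillaEncinasVillamayor2012 Lemma 4.6;
KawanoueMatsuki2010; Kawanoue arXiv:math/0607009; CossartPiltant2008 §2; Cossart2011 ex. III.2; Hauser
arXiv:0811.4151; FruehbisKrueger arXiv:1007.2203 §3; BenitoVillamayor arXiv:1004.1803; Lucas 1878.)
-/

noncomputable section

open CategoryTheory AlgebraicGeometry IsLocalRing
open Literature.AlgebraicGeometry.Resolution
open Summit.ResolutionOfSingularities.ResolutionOfSingularities.Theorems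
open WeakOrderReduction ForcedTowerClasses DivergentTowerClasses MonomialTowerClasses
open HugDimensionClasses HugDimensionKernels SurfaceShadowClasses SurfaceShadowKernels
open NearPointCut (SingularClass)
open AbsoluteContactClasses (IsAbsContactAt SepResidueAt diffIdeal_restrict_le stalkMap_comp_toStalk_eq_stalkHom)
open scoped BigOperators

namespace Summit.ResolutionOfSingularities.ResolutionOfSingularities.Theorems.HugValuationCut

/-! ## §70 (g26 · NEW) THE CUT OF THE g25 LOCATED RESIDUAL BY THE COMPANION LAW — cells and EXACT re-locations BY NAME

`WildKangarooOffDoublePointTowersTerminate n` (g25's located residual: wild, off-locus singular class, `p`-power form at every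
marked point, weight-`n` kangaroo-recurrent, off the double-point/dim-4 cell) ⟺
(EVENTUALLY COMPANION-JUMP-FREE bed — DECIDED: ⊆ `ContactHugging` by
`contactHugging_of_eventuallyCompanionJumpFree`, settled
by `ContactHuggingTowersTerminate n` / 31571 BY NAME, no port) ∧ (COMPANION-RECURRENT bed — THE LOCATED RESIDUAL after g26:
in EVERY weight `p^e ∣ n` … every `1 ≤ w ≤ n` … a typed companion jump interrupts EVERY germ from EVERY stage; by
`exists_cInv_stage` this is, over a perfect field, literally «infinitely many companion kangaroo jumps along every
companion-contact hypersurface, in every weight» — the weight-`p` companion INCLUDED, which g24/g25 could not see at the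
weights `p², 2p, …`). -/

section CompanionCells

/-- **CELL (g25 residual ∧ EVENTUALLY COMPANION-JUMP-FREE)** — DECIDED (31571's class by
`contactHugging_of_eventuallyCompanionJumpFree`; census profile: the `(p, n) = (2, 4)` chains whose weight-2 companion
`Diff^{≤2}_ℤ(𝓘)` keeps the initial form `ȳ²` in the transported coordinate, e.g. 2:R3L:y²+x⁵+x⁴u³
(in₄ = (xy)², y²(u+x)², (yu)²:
companion ∋ y² at every replayed node) — in g25's RESIDUAL at weight 4, DECIDED here). -/
def WildCompanionJumpFreeTowersTerminate (n : ℕ) : Prop :=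
  NoTowerWild n fun T =>
    ((((SingularClass T ∧ Nonempty (MarkedShadow T n)) ∧ PPowerTower n T) ∧ ¬ EventuallyJumpFree n T) ∧
      ¬ (n = 2 ∧ DoublePointTower T)) ∧ EventuallyCompanionJumpFree n T

/-- **CELL (g25 residual ∧ COMPANION-RECURRENT) · THE LOCATED RESIDUAL after g26** — UNDECIDED · IDEA-NEEDED
(a law bounding
the number of COMPANION kangaroo jumps in the least weight: Moh's bound on the residual order of the weight-`p` companion /
Hauser's kangaroo arithmetic / Cossart–Piltant's `ω` on the companion; census profile: the six `ℓ⁴`-stage chains of the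
`(2,4)` kangjump census whose weight-2 companion itself jumps at every exceptional stage). -/
def WildCompanionKangarooTowersTerminate (n : ℕ) : Prop :=
  NoTowerWild n fun T =>
    ((((SingularClass T ∧ Nonempty (MarkedShadow T n)) ∧ PPowerTower n T) ∧ ¬ EventuallyJumpFree n T) ∧
      ¬ (n = 2 ∧ DoublePointTower T)) ∧ ¬ EventuallyCompanionJumpFree n T

/-- **KERNEL (pure logic): every class splits EXACTLY by `EventuallyCompanionJumpFree`.** [folklore] -/
theorem noTowerWild_split_companionJumpFree {n : ℕ} (P : ForcedTower → Prop) :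
    NoTowerWild n P ↔
      NoTowerWild n (fun T => P T ∧ EventuallyCompanionJumpFree n T) ∧
        NoTowerWild n (fun T => P T ∧ ¬ EventuallyCompanionJumpFree n T) :=
  noTowerWild_split _ _

/-- **KERNEL (PROVED, no port): the eventually companion-jump-free column of EVERY class is settled by
`ContactHuggingTowersTerminate n`** (31571 at the weight) — the general form of the cut, applicable verbatim to every other
lens's tower residual. [folklore] -/
theorem noTowerWild_companionJumpFree_of_contact {n : ℕ} (P : ForcedTower → Prop) (h : ContactHuggingTowersTerminate n) :
    NoTowerWild n fun T => P T ∧ EventuallyCompanionJumpFree n T :=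
  noTowerWild_mono (fun _ hT => contactHugging_of_eventuallyCompanionJumpFree hT.2) (noTowerWild_of_noTower h)

/-- **EXACT (pure logic): the g25 located residual = the companion-jump-free bed ∧ the companion-recurrent bed.**
[folklore] -/
theorem wildKangarooOffDoublePoint_iff_g26 {n : ℕ} :
    WildKangarooOffDoublePointTowersTerminate n ↔
      WildCompanionJumpFreeTowersTerminate n ∧ WildCompanionKangarooTowersTerminate n :=
  noTowerWild_split_companionJumpFree _

/-- **KERNEL (PROVED, no port): the companion-jump-free bed terminates as soon as 31571 does at the weight.** [folklore] -/
theorem wildCompanionJumpFree_of_contact {n : ℕ} (h : ContactHuggingTowersTerminate n) :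
    WildCompanionJumpFreeTowersTerminate n :=
  noTowerWild_companionJumpFree_of_contact _ h

/-- **EXACT GIVEN 31571 at the weight: the g25 residual ⟺ the companion-recurrent bed.** [folklore] -/
theorem wildKangarooOffDoublePoint_iff_companion {n : ℕ} (h : ContactHuggingTowersTerminate n) :
    WildKangarooOffDoublePointTowersTerminate n ↔ WildCompanionKangarooTowersTerminate n := by
  rw [wildKangarooOffDoublePoint_iff_g26]
  exact ⟨fun h' => h'.2, fun h' => ⟨wildCompanionJumpFree_of_contact h, h'⟩⟩

/-- the companion-recurrent bed is a sub-residual of g25's (hypothesis-free). [folklore] -/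
theorem wildCompanionKangaroo_of_g25 {n : ℕ} (h : WildKangarooOffDoublePointTowersTerminate n) :
    WildCompanionKangarooTowersTerminate n :=
  (wildKangarooOffDoublePoint_iff_g26.mp h).2

/-- BY NAME: **no wild tower of the g25 residual class with finitely many companion jumps** (DECIDED by 31571). -/
def NoWildCompanionJumpFreeTowers : Prop := ∀ n : ℕ, 1 ≤ n → WildCompanionJumpFreeTowersTerminate n

/-- BY NAME: **no wild COMPANION-RECURRENT tower** — THE LOCATED RESIDUAL of the aside chain
`NoWildContactFreeOffLocusTowers ⊇ NoWildPPowerOffLocusTowers ⊇ NoWildKangarooOffLocusTowers ⊇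
NoWildKangarooOffDoublePointTowers ⊇ ·`
after g26. -/
def NoWildCompanionKangarooTowers : Prop := ∀ n : ℕ, 1 ≤ n → WildCompanionKangarooTowersTerminate n

/-- **EXACT RE-LOCATION BY NAME (pure logic): the g25 residual ⟺ (companion-jump-free bed) ∧ (companion-recurrent bed).**
[folklore] -/
theorem noWildKangarooOffDoublePointTowers_iff_g26 :
    NoWildKangarooOffDoublePointTowers ↔ NoWildCompanionJumpFreeTowers ∧ NoWildCompanionKangarooTowers :=
  ⟨fun h => ⟨fun n hn => (wildKangarooOffDoublePoint_iff_g26.mp (h n hn)).1,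
      fun n hn => (wildKangarooOffDoublePoint_iff_g26.mp (h n hn)).2⟩,
    fun h n hn => wildKangarooOffDoublePoint_iff_g26.mpr ⟨h.1 n hn, h.2 n hn⟩⟩

/-- up-link (hypothesis-free direction): the g26 residual ⟸ the g25 residual ⟸ g24's ⟸ g23's ⟸ the tree
aside. [folklore] -/
theorem noWildCompanionKangarooTowers_of_g25 (h : NoWildKangarooOffDoublePointTowers) : NoWildCompanionKangarooTowers :=
  (noWildKangarooOffDoublePointTowers_iff_g26.mp h).2

/-- up-link from the TREE aside `NoWildContactFreeOffLocusTowers`. [folklore] -/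
theorem noWildCompanionKangarooTowers_of_aside (h : NoWildContactFreeOffLocusTowers) : NoWildCompanionKangarooTowers :=
  noWildCompanionKangarooTowers_of_g25
    (noWildKangarooOffLocusTowers_iff_g25.mp (noWildKangarooOffLocusTowers_of_aside h))

/-- **THE g24 DECIDED BED LIES IN THE g26 DECIDED BED, class level (KERNEL, PROVED)**: for any class `A`,
`NoTowerWild n (A ∧ EventuallyCompanionJumpFree) → NoTowerWild n (A ∧ EventuallyJumpFree)` (`w := n`). [folklore] -/
theorem noTowerWild_jumpFree_of_companionJumpFree {n : ℕ} (hn : 1 ≤ n) (A : ForcedTower → Prop)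
    (h : NoTowerWild n fun T => A T ∧ EventuallyCompanionJumpFree n T) :
    NoTowerWild n fun T => A T ∧ EventuallyJumpFree n T :=
  noTowerWild_mono (fun _ hT => ⟨hT.1, eventuallyCompanionJumpFree_of_eventuallyJumpFree hn hT.2⟩) h

end CompanionCells

end Summit.ResolutionOfSingularities.ResolutionOfSingularities.Theorems.HugValuationCut
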